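import Summits.ABC.StewartYu.PadicTwoKStep
import Summits.ABC.StewartYu.DescentStepThirdQ
import HarnessLib

/-!
# Cell abc-stewartyu, W80Two (vii): the `2`-adic TRIADIC descent — invariant, inner chain,
# composition (the `Prop` layer)

`Summits/ABC/StewartYu/PadicTwoMain.lean` — cell `abc-stewartyu` (HOME
`run/shared/lean/pub/abc-stewartyu/`, seat p2; route `PadicPrimesW80TwoThirds`, crux `W80Two`
stmt-ABC-19486), sequel to `PadicTwoKStep.lean` and `DescentStepThirdQ.lean`.  Plain definitions
(`Prop`s) and theorems; no named fact.  TWIN of p2's `PadicTwistMain.lean` (odd `p`, dyadic levels,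
classed invariant) for `S : TwoSetup` (`p = 2`, generators `≡ 1 (mod 8)`, NO class) at BASE `3`
(Yu's `q = 3` descent; the record-side ruling of p1-g5, 2026-08-26T11:16Z: the inner k-steps TRIPLE
the range, `d` of them per level, so that the `3^{d+2} − 1` exponent of the multicubic Liouville
inequality is paid by `2·3^{d+J−1} S₀` zeros):

* the invariant is the place-free `SetupQ.Inv3` of `DescentLevelsThirdQ.lean` (support in `box3 J`,
  `coreSum3_{J,τ}(s) = 0` for `s < 3ᴶ S₀`, `3 ∤ s`, `|τ| < T/3ᴶ`);
* `KSizes3`, `KFinal3` — the archimedean sizes and the numerical inequality of the inner steps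
  (`KFinal3` is literally the hypothesis `hfinal` of `padic_kstep3` at `N = 3^{k+J} S₀`);
* `kchain3` — PROVED: `d` applications of `padic_kstep3` at level `J`;
* `ThirdStep`, `Siegel3`, `Endgame3` — the remaining inputs as `Prop`s (the third step is
  discharged in `PadicTwoThirdStep.lean` from sizes and the third-point inequality; Siegel by
  `SetupQ.siegel3`; the endgame by `SetupQ.w80_endgame3`);
* `inv3_succ`, `inv3_all`, `main3` — PROVED compositions; `endgame3_of_numbers`, `siegel3_of_count`.

## References
* [Yu1989] K. Yu, *Linear forms in p-adic logarithms*, Acta Arith. 53 (1989), §3.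
* [Yu1990] K. Yu, *Linear forms in p-adic logarithms II*, Compositio Math. 74 (1990), §3 (p = 2).
* [Waldschmidt1980] M. Waldschmidt, Acta Arith. 37 (1980), §§3.4–3.5.
-/

noncomputable section

open NormedSpace Finset IsUltrametricDist
open Literature.NumberTheory.Transcendental
open Literature.NumberTheory.Transcendental.CW77.Setup (Idx Tau tauNorm tauSet mem_tauSet)
open Literature.NumberTheory.Transcendental.PadicCW77 (condExp)
open scoped Nat

namespace Summit.ABC.StewartYu

namespace TwoSetup

variable (S : TwoSetup) {h Lb : ℕ}

/-! ### The inputs of the inner chain at level `J` -/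

/-- **Archimedean sizes of the cores at level `J` of the triadic descent** (shape of
`TwistSetup.KSizes` at base `3`; Yu's schedule: the `k`-th inner step TRIPLES the range): for the
`k`-th step (`k < d`), every `|τ| + t ≤ T/3ᴶ − k t` and every `s₁ < 3^{k+1+J} S₀` with `3 ∤ s₁`, a
denominator `0 < D ≤ Dmax k` with `D · coreSum3 ∈ ℤ` and `|coreSum3| ≤ Mmax k`.
[cite: Yu1989, §3 Lemma 3.3] [cite: Waldschmidt1980, §3.3 (3.19)–(3.21) (p. 269)] -/
def KSizes3 (J₀ J : ℕ) (L : Fin S.d → ℕ) (Lθ S₀ T t : ℕ) (pv : Idx S.d h Lb → ℤ)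
    (Dmax Mmax : ℕ → ℝ) : Prop :=
  ∀ k, k < S.d → ∀ τ : Tau S.d, tauNorm τ + t ≤ T / 3 ^ J - k * t →
    ∀ s₁, s₁ < 3 ^ (k + 1 + J) * S₀ → ¬ 3 ∣ s₁ →
      ∃ D : ℕ, 0 < D ∧ (D : ℝ) ≤ Dmax k ∧
        (∃ m : ℤ, (D : ℚ) * S.toQ.coreSum3 J₀ J (S.toQ.box3 (h := h) (Lb := Lb) L Lθ J) pv τ s₁ = m) ∧
        |(S.toQ.coreSum3 J₀ J (S.toQ.box3 (h := h) (Lb := Lb) L Lθ J) pv τ s₁ : ℝ)| ≤ Mmax k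

/-- **The numerical inequality of the `k`-th inner step at level `J`** (`p = 2`; node range
`N = 3^{k+J} S₀`, nodes `{s < 3⌊N/3⌋ : 3 ∤ s}` — `2⌊N/3⌋` of them —, multiplicity `t`; weight radius
`4`, unit disc), literally the hypothesis `hfinal` of `padic_kstep3`:
`max (2^{hLb} ‖Λ₀‖₂ 2ᵗ 2^{condExp 2 N t}) (8^{hLb} / 4^{2⌊N/3⌋·t}) < 1/(Dmax k · Mmax k)`.
The first branch carries the `2`-adic sizes `‖1/wDen‖₂ ≤ 2^{hLb}`, `‖1/k!‖₂ ≤ 2ᵏ`, the factor `2` of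
Lemma 9 on `‖z‖ ≤ 2`, and the conditioning of the small-jets Schwarz lemma by residues mod `2ʲ` among
ALL `s < N` (`PadicCW77.condExp 2 N t`, at the range); the second is the Schwarz gain `log 4` per
zero against lit's weighted coefficient bound `8^{hLb}`.
[cite: Yu1989, §3 Lemma 3.3] [cite: Waldschmidt1980, Lemma 3.6 (p. 272)] -/
def KFinal3 (J : ℕ) (S₀ t : ℕ) (Dmax Mmax : ℕ → ℝ) : Prop :=
  ∀ k, k < S.d →
    max ((2 : ℝ) ^ (h * Lb) * ‖S.Λ₀‖ * (2 : ℝ) ^ t * (2 : ℝ) ^ condExp 2 (3 ^ (k + J) * S₀) t)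
        ((8 : ℝ) ^ (h * Lb) / (4 : ℝ) ^ (2 * (3 ^ (k + J) * S₀ / 3) * t)) <
      1 / (Dmax k * Mmax k)

/-! ### The inner chain, proved -/

/-- **The inner chain at level `J`**: from the invariant `Inv3` at level `J`, for every `k ≤ d`,
`coreSum3_{J,τ}(s) = 0` for `s < 3^{k+J} S₀`, `3 ∤ s`, `|τ| < T/3ᴶ − k t` (`t ≥ 1`), by `k`
applications of the `2`-adic k-step `padic_kstep3`.
[cite: Yu1989, §3 Lemma 3.3] [cite: Waldschmidt1980, Lemma 3.6 (p. 272)] -/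
theorem kchain3 {J₀ J : ℕ} {L : Fin S.d → ℕ} {Lθ S₀ T t : ℕ} {P : ℤ} {pv : Idx S.d h Lb → ℤ}
    (inv : S.toQ.Inv3 J₀ L Lθ S₀ T P J pv) (ht : 1 ≤ t)
    (hΛ : ‖S.Λ₀‖ ≤ (8 : ℝ)⁻¹)
    {Dmax Mmax : ℕ → ℝ} (hsz : S.KSizes3 J₀ J L Lθ S₀ T t pv Dmax Mmax)
    (hfin : S.KFinal3 (h := h) (Lb := Lb) J S₀ t Dmax Mmax) :
    ∀ k, k ≤ S.d → ∀ s, s < 3 ^ (k + J) * S₀ → ¬ 3 ∣ s → ∀ τ : Tau S.d,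
      tauNorm τ < T / 3 ^ J - k * t →
      S.toQ.coreSum3 J₀ J (S.toQ.box3 (h := h) (Lb := Lb) L Lθ J) pv τ s = 0 := by
  intro k
  induction k with
  | zero =>
    intro _ s hs h3 τ hτ
    rw [zero_add] at hs
    exact inv.rel s hs h3 τ (by simpa using hτ)
  | succ k ih =>
    intro hk s hs h3 τ hτ
    have hk' : k < S.d := by omega
    have hzero := ih hk'.le
    have key := S.padic_kstep3 J₀ J (S.toQ.box3 (h := h) (Lb := Lb) L Lθ J) pv
      (N := 3 ^ (k + J) * S₀) (N' := 3 ^ (k + 1 + J) * S₀)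
      (Tlo := T / 3 ^ J - k * t) (t := t) ht hzero hΛ
      (Dmax := Dmax k) (Mmax := Mmax k) (hsz k hk') (hfin k hk')
    refine key s hs h3 τ ?_
    rw [Nat.succ_mul] at hτ
    omega

/-! ### The inputs of the outer induction and the composition -/

/-- **The third step at level `J`**: from the invariant at level `J` with integer bound `P` and the
vanishing delivered by the inner chain (`s < 3^{d+J} S₀`, `3 ∤ s`, `|τ| < T/3ᴶ − d t`), the
invariant at level `J + 1` with the same bound. [cite: Yu1989, §3 Lemmas 3.4–3.5] -/
def ThirdStep (J₀ J : ℕ) (L : Fin S.d → ℕ) (Lθ S₀ T t : ℕ) (P : ℤ) : Prop :=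
  ∀ pv : Idx S.d h Lb → ℤ, S.toQ.Inv3 J₀ L Lθ S₀ T P J pv →
    (∀ s, s < 3 ^ (S.d + J) * S₀ → ¬ 3 ∣ s → ∀ τ : Tau S.d, tauNorm τ < T / 3 ^ J - S.d * t →
      S.toQ.coreSum3 J₀ J (S.toQ.box3 (h := h) (Lb := Lb) L Lθ J) pv τ s = 0) →
    ∃ pv' : Idx S.d h Lb → ℤ, S.toQ.Inv3 J₀ L Lθ S₀ T P (J + 1) pv'

/-- **Level `0`: Siegel's lemma** (at `p = 2` there is no class: `SetupQ.siegel3` on the whole box).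
[cite: Yu1989, §3 Lemma 3.1] [cite: Waldschmidt1980, Lemma 3.2 (pp. 266–267)] -/
def Siegel3 (J₀ : ℕ) (L : Fin S.d → ℕ) (Lθ S₀ T : ℕ) (P : ℤ) : Prop :=
  ∃ pv : Idx S.d h Lb → ℤ, S.toQ.Inv3 J₀ L Lθ S₀ T P 0 pv

/-- **The contradiction at the top level `J₀`** (`SetupQ.w80_endgame3`). [cite: Yu1989, §3]
[cite: Waldschmidt1980, §3.5 (p. 274)] -/
def Endgame3 (J₀ : ℕ) (L : Fin S.d → ℕ) (Lθ S₀ T : ℕ) (P : ℤ) : Prop :=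
  ∀ pv : Idx S.d h Lb → ℤ, S.toQ.Inv3 J₀ L Lθ S₀ T P J₀ pv → False

/-- **The invariant passes from `J` to `J + 1`**: inner chain, then the third step.
[cite: Yu1989, §3] -/
theorem inv3_succ {J₀ J : ℕ} {L : Fin S.d → ℕ} {Lθ S₀ T : ℕ} {P : ℤ} {t : ℕ → ℕ}
    (ht : 1 ≤ t J) (hΛ : ‖S.Λ₀‖ ≤ (8 : ℝ)⁻¹) {Dmax Mmax : ℕ → ℕ → ℝ}
    (hsz : ∀ pv : Idx S.d h Lb → ℤ, S.toQ.Inv3 J₀ L Lθ S₀ T P J pv →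
      S.KSizes3 J₀ J L Lθ S₀ T (t J) pv (Dmax J) (Mmax J))
    (hfin : S.KFinal3 (h := h) (Lb := Lb) J S₀ (t J) (Dmax J) (Mmax J))
    (hthird : S.ThirdStep (h := h) (Lb := Lb) J₀ J L Lθ S₀ T (t J) P)
    {pv : Idx S.d h Lb → ℤ} (inv : S.toQ.Inv3 J₀ L Lθ S₀ T P J pv) :
    ∃ pv' : Idx S.d h Lb → ℤ, S.toQ.Inv3 J₀ L Lθ S₀ T P (J + 1) pv' :=
  hthird pv inv (S.kchain3 inv ht hΛ (hsz pv inv) hfin S.d le_rfl)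

/-- **The invariant at every level `J ≤ J₀`.** [cite: Yu1989, §3] -/
theorem inv3_all {J₀ : ℕ} {L : Fin S.d → ℕ} {Lθ S₀ T : ℕ} {P : ℤ} {t : ℕ → ℕ}
    (ht : ∀ J, J < J₀ → 1 ≤ t J) (hΛ : ‖S.Λ₀‖ ≤ (8 : ℝ)⁻¹)
    {Dmax Mmax : ℕ → ℕ → ℝ}
    (hsz : ∀ J, J < J₀ → ∀ pv : Idx S.d h Lb → ℤ, S.toQ.Inv3 J₀ L Lθ S₀ T P J pv →
      S.KSizes3 J₀ J L Lθ S₀ T (t J) pv (Dmax J) (Mmax J))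
    (hfin : ∀ J, J < J₀ → S.KFinal3 (h := h) (Lb := Lb) J S₀ (t J) (Dmax J) (Mmax J))
    (hthird : ∀ J, J < J₀ → S.ThirdStep (h := h) (Lb := Lb) J₀ J L Lθ S₀ T (t J) P)
    (hsiegel : S.Siegel3 (h := h) (Lb := Lb) J₀ L Lθ S₀ T P) :
    ∀ J, J ≤ J₀ → ∃ pv : Idx S.d h Lb → ℤ, S.toQ.Inv3 J₀ L Lθ S₀ T P J pv := by
  intro J
  induction J with
  | zero => intro _; exact hsiegel
  | succ J ih =>
    intro hJ
    obtain ⟨pv, inv⟩ := ih (by omega)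
    have hJ' : J < J₀ := by omega
    exact S.inv3_succ (ht J hJ') hΛ (hsz J hJ') (hfin J hJ') (hthird J hJ') inv

/-- **The `2`-adic machine**: if Siegel's lemma starts the triadic descent, the sizes and the
numerical inequalities of every inner step hold, the third steps pass the invariant up, and the top
level is contradictory, then the smallness hypothesis `‖Λ₀‖₂ ≤ 8⁻¹` is absurd.
[cite: Yu1989, §3 (proof of the main theorem for p = 2)] [cite: Waldschmidt1980, Prop. 3.8] -/
theorem main3 {J₀ : ℕ} {L : Fin S.d → ℕ} {Lθ S₀ T : ℕ} {P : ℤ} {t : ℕ → ℕ}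
    (ht : ∀ J, J < J₀ → 1 ≤ t J) (hΛ : ‖S.Λ₀‖ ≤ (8 : ℝ)⁻¹)
    {Dmax Mmax : ℕ → ℕ → ℝ}
    (hsz : ∀ J, J < J₀ → ∀ pv : Idx S.d h Lb → ℤ, S.toQ.Inv3 J₀ L Lθ S₀ T P J pv →
      S.KSizes3 J₀ J L Lθ S₀ T (t J) pv (Dmax J) (Mmax J))
    (hfin : ∀ J, J < J₀ → S.KFinal3 (h := h) (Lb := Lb) J S₀ (t J) (Dmax J) (Mmax J))
    (hthird : ∀ J, J < J₀ → S.ThirdStep (h := h) (Lb := Lb) J₀ J L Lθ S₀ T (t J) P)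
    (hsiegel : S.Siegel3 (h := h) (Lb := Lb) J₀ L Lθ S₀ T P)
    (hend : S.Endgame3 (h := h) (Lb := Lb) J₀ L Lθ S₀ T P) : False := by
  obtain ⟨pv, inv⟩ := S.inv3_all ht hΛ hsz hfin hthird hsiegel J₀ le_rfl
  exact hend pv inv

/-- **The endgame from numbers** (`SetupQ.w80_endgame3`: `L_θ < 3^{J₀}`, a budget `T'` with
`T' + ∑ Lⱼ/3^{J₀} ≤ T/3^{J₀}` and the count `h·Lb < T' · #{s < 3^{J₀} S₀ : 3 ∤ s}`).
[cite: Waldschmidt1980, §3.5 (p. 274)] -/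
theorem endgame3_of_numbers {J₀ : ℕ} {L : Fin S.d → ℕ} {Lθ S₀ T : ℕ} {P : ℤ} {T' : ℕ}
    (hcount : h * Lb < T' * (SetupQ.Pts3 (3 ^ J₀ * S₀)).card) (hLθ : Lθ < 3 ^ J₀)
    (hT' : T' + ∑ j, L j / 3 ^ J₀ ≤ T / 3 ^ J₀) :
    S.Endgame3 (h := h) (Lb := Lb) J₀ L Lθ S₀ T P :=
  fun _ inv => S.toQ.w80_endgame3 inv hLθ hT' hcount

/-- **Siegel's lemma from a count and a coefficient bound** (`SetupQ.siegel3`), in the shape of the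
`Prop` `Siegel3`. [cite: Yu1989, §3 Lemma 3.1] -/
theorem siegel3_of_count (J₀ : ℕ) (L : Fin S.d → ℕ) (Lθ S₀ T : ℕ) (hS₀ : 2 ≤ S₀) (hT : 1 ≤ T)
    (hcard : 2 * (SetupQ.Pts3 S₀ ×ˢ tauSet S.d T).card ≤
      (S.toQ.box3 (h := h) (Lb := Lb) L Lθ 0).card)
    (Dc : ℕ → Tau S.d → ℕ)
    (hDc : ∀ s, s < S₀ → ¬ 3 ∣ s → ∀ τ : Tau S.d, tauNorm τ < T → 0 < Dc s τ)
    (hint : ∀ s, s < S₀ → ¬ 3 ∣ s → ∀ τ : Tau S.d, tauNorm τ < T →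
      ∀ u ∈ S.toQ.box3 (h := h) (Lb := Lb) L Lθ 0,
        ∃ z : ℤ, (Dc s τ : ℚ) * S.toQ.qTerm3 J₀ 0 u τ s = z)
    {Amax : ℝ} (hAmax : 1 ≤ Amax)
    (hA : ∀ s, s < S₀ → ¬ 3 ∣ s → ∀ τ : Tau S.d, tauNorm τ < T →
      ∀ u ∈ S.toQ.box3 (h := h) (Lb := Lb) L Lθ 0,
        |((Dc s τ : ℕ) : ℝ) * (S.toQ.qTerm3 J₀ 0 u τ s : ℝ)| ≤ Amax) :
    S.Siegel3 (h := h) (Lb := Lb) J₀ L Lθ S₀ T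
      ⌈((S.toQ.box3 (h := h) (Lb := Lb) L Lθ 0).card : ℝ) * Amax⌉ :=
  S.toQ.siegel3 J₀ L Lθ S₀ T hS₀ hT hcard Dc hDc hint hAmax hA

end TwoSetup

end Summit.ABC.StewartYu

end
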